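import Literature.AlgebraicGeometry.Motives.HilbertImageInGrassmannianUniversalFamily
import Literature.AlgebraicGeometry.Motives.GrassmannianSchemeProper
import Literature.AlgebraicGeometry.Modules.ProjectiveFamilyTwistPushforward
import HarnessLib

/-!
# The Hilbert scheme of a polynomial `Q` in `𝐏(ι)` as an `S`-scheme, in the letters of cohomology-and-base-change

Layer `Literature/AlgebraicGeometry/Motives`, namespace `Literature.AlgebraicGeometry.Motives`.  Theorems only: no definition, no named
fact, no instance, no notation, no `sorry`.  Universe `0` (that of ★ `Motives/HilbertImageInGrassmannianUniversalFamily`).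

★ `Motives.exists_grassmannianImmersion_universal_flat_family` is THE Hilbert scheme `Hilb^Q_{𝐏(ι)}` over `Spec ℤ` ([Mumford1966CurvesSurface]
Lect. 15; [MumfordFogartyKirwan1994] Ch. 0 §5 (c)): a locally Noetherian `H` immersed in a Grassmannian, with a universal closed flat
family whose twists have ranks `R e` (`e ≥ e₀`), universal among such families over locally Noetherian bases.  This file re-reads it
(i) over an arbitrary locally Noetherian base `S` (`HS := H × S`, separated and locally of finite type over `S`), and (ii) in the
currency of the two LETTERS at field points «`Ext¹(𝒪_{X₀}, k^*𝒪_Z(e)) = 0` and `dim_K Γ(X₀, k^*𝒪_Z(e)) = Q(e)` for every `e ≥ B(Q) − 1`»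
instead of `HasRank` (★ `forall_fieldPoint_letters_of_hasRank_twists` one way, ★ `Modules.hasRank_pushforward_twistMod_of_forall_fieldPoint`
the other), for an ADMISSIBLE `Q` (`⌊Q(e)⌋₊ = Q(e)` beyond Mumford's threshold, so `R e := ⌊Q(e)⌋₊`):

* **`exists_hilbertScheme_over_letters`** — `∃ (h : HS → S)` locally Noetherian, separated, locally of finite type, with a closed FLAT
  family `iH : Z_Q ↪ 𝐏(ι; HS)` having the letters `Q` at every field point (SELF), such that every closed flat `Z ↪ 𝐏(ι; T)` over a
  locally Noetherian `S`-scheme `v : T → S` with the letters `Q` at every field point is the pull-back of `Z_Q` along a UNIQUE `w : T → HS`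
  over `S` (UNIV).  This is sub-letter (B1) `stub_IIb4B1_hilbertLayer` of the Hom-scheme child line `F4IIbHomScheme` VERBATIM.

Cell hodgecm-mathlib, F-4 (II-b) child line `F4IIbHomScheme` (F0P1a-plan (g0) CARD v1 bfb5aec2; skeleton v0.2 b123615b), stub (B1);
B-p14 (g20) custodian draft.  Count-neutral capital: HC_CM is proved only modulo the 7 printed citations until rung 0 closes; nothing here
bears on it.

## References

* D. Mumford, *Lectures on Curves on an Algebraic Surface* (1966), Lecture 15 (II.)–(V.) (pp. 105–108). [Mumford1966CurvesSurface]
* D. Mumford, J. Fogarty, F. Kirwan, *Geometric Invariant Theory* (3rd ed., 1994), Ch. 0 §5 (c) (p. 23). [MumfordFogartyKirwan1994]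
* U. Görtz, T. Wedhorn, *Algebraic Geometry II* (2023), Cor. 22.91 (p. 277). [GortzWedhorn2023]
-/

noncomputable section

set_option backward.isDefEq.respectTransparency false

open CategoryTheory CategoryTheory.Limits CategoryTheory.Abelian AlgebraicGeometry Polynomial
open Literature.Algebra.Homology Literature.Algebra.Homology.LaurentCech Literature.Algebra.Homology.OrderedCech
open Literature.AlgebraicGeometry Literature.AlgebraicGeometry.Modules Literature.AlgebraicGeometry.Modules.SerreTwist

namespace Literature.AlgebraicGeometry.Motives

/-- `Ext`-vanishing transports along an isomorphism of the second argument. [folklore] -/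
private theorem subsingleton_ext_of_iso₅ {C : Type*} [Category C] [Abelian C] [HasExt.{1} C] (P : C) {Y Y' : C}
    (e : Y ≅ Y') (i : ℕ) (h : Subsingleton (Ext.{1} P Y' i)) : Subsingleton (Ext.{1} P Y i) := by
  refine subsingleton_of_forall_eq 0 fun x => ?_
  have hx : x = (x.comp (Ext.mk₀ e.hom) (add_zero i)).comp (Ext.mk₀ e.inv) (add_zero i) := by
    rw [Ext.comp_assoc_of_second_deg_zero, Ext.mk₀_comp_mk₀, e.hom_inv_id, Ext.comp_mk₀_id]
  rw [hx, Subsingleton.elim (x.comp (Ext.mk₀ e.hom) (add_zero i)) 0, Ext.zero_comp]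

/-- `𝐏(ι; -)` is functorial (without `[Finite ι]`): `𝐏(a ≫ b) = 𝐏(a) ≫ 𝐏(b)`. [cite: StacksProject, Tag 01NF] -/
private theorem projectiveSpaceMap_comp'' (ι : Type) {S T T' : Scheme.{0}} (a : T' ⟶ T) (b : T ⟶ S) :
    Morphisms.projectiveSpaceMap ι (a ≫ b) = Morphisms.projectiveSpaceMap ι a ≫ Morphisms.projectiveSpaceMap ι b := by
  apply pullback.hom_ext
  · rw [Morphisms.projectiveSpaceMap_fst, Category.assoc, Morphisms.projectiveSpaceMap_fst,
      Morphisms.projectiveSpaceMap_fst_assoc]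
  · rw [Morphisms.projectiveSpaceMap_snd, Category.assoc, Morphisms.projectiveSpaceMap_snd, Morphisms.projectiveSpaceMap_snd]

/-- A field point of a base change of an embedded family reads the fibre of the family and the same module (★
`isPullback_projectiveSpaceMap` pasted, ★ `SerreTwist.exists_pullback_twistMod_unitModule_iso`). [cite: StacksProject, Tag 01NF] -/
private theorem fieldPoint_of_baseChange {ι : Type} {T Z T' Z' : Scheme.{0}} (i : Z ⟶ Morphisms.projectiveSpace ι T)
    (v : T' ⟶ T) (g : Z' ⟶ Z) (i' : Z' ⟶ Morphisms.projectiveSpace ι T') (Hg : IsPullback g i' i (Morphisms.projectiveSpaceMap ι v))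
    {K : Type} [Field K] {X₀ : Scheme.{0}} (k' : X₀ ⟶ Z') (f₀ : X₀ ⟶ Spec (CommRingCat.of K))
    (x' : Spec (CommRingCat.of K) ⟶ T') (H' : IsPullback k' f₀ (i' ≫ Morphisms.projectiveSpaceFst ι T') x') :
    IsPullback (k' ≫ g) f₀ (i ≫ Morphisms.projectiveSpaceFst ι T) (x' ≫ v) ∧
      ∀ e : ℕ, Nonempty ((Scheme.Modules.pullback (k' ≫ g)).obj
          (twistMod (i ≫ pullback.snd (terminal.from T) (terminal.from (Morphisms.projectiveSpaceInt ι))) (unitModule Z) e) ≅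
        (Scheme.Modules.pullback k').obj
          (twistMod (i' ≫ pullback.snd (terminal.from T') (terminal.from (Morphisms.projectiveSpaceInt ι))) (unitModule Z') e)) := by
  have HZ : IsPullback g (i' ≫ Morphisms.projectiveSpaceFst ι T') (i ≫ Morphisms.projectiveSpaceFst ι T) v :=
    Hg.paste_vert (Morphisms.isPullback_projectiveSpaceMap ι v)
  refine ⟨H'.paste_horiz HZ, fun e => ?_⟩
  have hsnd : i' ≫ pullback.snd (terminal.from T') (terminal.from (Morphisms.projectiveSpaceInt ι)) =
      g ≫ (i ≫ pullback.snd (terminal.from T) (terminal.from (Morphisms.projectiveSpaceInt ι))) := by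
    rw [← Morphisms.projectiveSpaceMap_snd ι v, ← Category.assoc, ← Hg.w, Category.assoc]
  obtain ⟨φ, -⟩ := exists_pullback_twistMod_unitModule_iso g
    (i ≫ pullback.snd (terminal.from T) (terminal.from (Morphisms.projectiveSpaceInt ι))) e
  have hobj : twistMod (i' ≫ pullback.snd (terminal.from T') (terminal.from (Morphisms.projectiveSpaceInt ι))) (unitModule Z') e =
      twistMod (g ≫ (i ≫ pullback.snd (terminal.from T) (terminal.from (Morphisms.projectiveSpaceInt ι)))) (unitModule Z') e :=
    congrArg (fun f => twistMod f (unitModule Z') e) hsnd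
  exact ⟨((Scheme.Modules.pullbackComp k' g).app _).symm ≪≫ (Scheme.Modules.pullback k').mapIso (φ ≪≫ eqToIso hobj.symm)⟩

/-- **THE HILBERT SCHEME OF `Q` OVER `S`, IN LETTERS** (= sub-letter (B1) `stub_IIb4B1_hilbertLayer` of `F4IIbHomScheme` VERBATIM).
Construction: `H, Z_H` := ★ `exists_grassmannianImmersion_universal_flat_family hn Q e₁ R hR` with `e₁ := (B(Q) − 1).toNat`,
`R e := ⌊Q(e)⌋₊` (admissibility gives `hR`); `HS := H × S` (Mathlib `pullback (terminal.from H) (terminal.from S)`), separated and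
locally of finite type over `S` because `H ↪ Gr` (immersion) and `Gr → Spec ℤ` are (★ `Grassmannian.isSeparated_terminal_from`,
`locallyOfFiniteType_terminal_from`), locally Noetherian over the locally Noetherian `S`; `Z_Q := Z_H ×_{𝐏(ι;H)} 𝐏(ι; HS)`.  SELF: ★
`forall_fieldPoint_letters_of_hasRank_twists` at `d ≥ B(Q) − 1` on `H`, transported to `HS`.  UNIV: the letters give
`HasRank ((p_Z)_*𝒪_Z(e)) ⌊Q(e)⌋₊` for `e ≥ B(Q) − 1 ⊇ [e₀, ∞)` (★ `Modules.hasRank_pushforward_twistMod_of_forall_fieldPoint`), so ★'s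
`∃! v : T → H`; `w := (v, given) : T → H × S`, the square by `𝐏(w) ≫ 𝐏(pr_H) = 𝐏(v)`.
[cite: Mumford1966CurvesSurface, Lecture 15 (II.)–(V.) (pp. 105–108)] [cite: MumfordFogartyKirwan1994, Ch. 0 §5 (c) (p. 23)]
[cite: GortzWedhorn2023, Cor. 22.91 (p. 277)] -/
theorem exists_hilbertScheme_over_letters : ∀ ⦃S : Scheme.{0}⦄ [IsLocallyNoetherian S] {ι : Type} (_ : 1 ≤ Nat.card ι) (Q : ℚ[X])
    (_ : ∀ e : ℕ, regularityBound (preHilbertPoly ℚ (Nat.card ι) 0) 0 (preHilbertPoly ℚ (Nat.card ι) 0 - Q) - 1 ≤ (e : ℤ) →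
      ((⌊Q.eval (e : ℚ)⌋₊ : ℕ) : ℚ) = Q.eval (e : ℚ)),
    ∃ (HS : Scheme.{0}) (h : HS ⟶ S) (_ : IsLocallyNoetherian HS) (_ : IsSeparated h) (_ : LocallyOfFiniteType h)
      (ZH : Scheme.{0}) (iH : ZH ⟶ Morphisms.projectiveSpace ι HS) (_ : IsClosedImmersion iH)
      (_ : Flat (iH ≫ Morphisms.projectiveSpaceFst ι HS)),
      -- SELF: the universal family has the letters `Q`
      (∀ ⦃K : Type⦄ [Field K] ⦃X₀ : Scheme.{0}⦄ (k : X₀ ⟶ ZH) (f₀ : X₀ ⟶ Spec (CommRingCat.of K))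
        (x : Spec (CommRingCat.of K) ⟶ HS), IsPullback k f₀ (iH ≫ Morphisms.projectiveSpaceFst ι HS) x →
        ∀ e : ℕ, regularityBound (preHilbertPoly ℚ (Nat.card ι) 0) 0 (preHilbertPoly ℚ (Nat.card ι) 0 - Q) - 1 ≤ (e : ℤ) →
          Subsingleton (CategoryTheory.Abelian.Ext.{1} (unitModule X₀) ((Scheme.Modules.pullback k).obj
            (twistMod (iH ≫ pullback.snd (terminal.from HS) (terminal.from (Morphisms.projectiveSpaceInt ι))) (unitModule _) e)) 1) ∧
          ((Module.finrank Γ(Spec (CommRingCat.of K), ⊤) (SecMod ((Scheme.Modules.pullback k).obj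
            (twistMod (iH ≫ pullback.snd (terminal.from HS) (terminal.from (Morphisms.projectiveSpaceInt ι))) (unitModule _) e))
            f₀.appTop.hom ⊤) : ℕ) : ℚ) = Q.eval (e : ℚ)) ∧
      -- UNIV over `S`
      ∀ ⦃T : Scheme.{0}⦄ [IsLocallyNoetherian T] (v : T ⟶ S) ⦃Z : Scheme.{0}⦄ (i : Z ⟶ Morphisms.projectiveSpace ι T)
        [IsClosedImmersion i] [Flat (i ≫ Morphisms.projectiveSpaceFst ι T)],
        (∀ ⦃K : Type⦄ [Field K] ⦃X₀ : Scheme.{0}⦄ (k : X₀ ⟶ Z) (f₀ : X₀ ⟶ Spec (CommRingCat.of K))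
          (x : Spec (CommRingCat.of K) ⟶ T), IsPullback k f₀ (i ≫ Morphisms.projectiveSpaceFst ι T) x →
          ∀ e : ℕ, regularityBound (preHilbertPoly ℚ (Nat.card ι) 0) 0 (preHilbertPoly ℚ (Nat.card ι) 0 - Q) - 1 ≤ (e : ℤ) →
            Subsingleton (CategoryTheory.Abelian.Ext.{1} (unitModule X₀) ((Scheme.Modules.pullback k).obj
              (twistMod (i ≫ pullback.snd (terminal.from T) (terminal.from (Morphisms.projectiveSpaceInt ι))) (unitModule _) e)) 1) ∧
            ((Module.finrank Γ(Spec (CommRingCat.of K), ⊤) (SecMod ((Scheme.Modules.pullback k).obj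
              (twistMod (i ≫ pullback.snd (terminal.from T) (terminal.from (Morphisms.projectiveSpaceInt ι))) (unitModule _) e))
              f₀.appTop.hom ⊤) : ℕ) : ℚ) = Q.eval (e : ℚ)) →
        ∃! w : T ⟶ HS, w ≫ h = v ∧ ∃ e : Z ⟶ ZH, IsPullback e i iH (Morphisms.projectiveSpaceMap ι w)  := by
  intro S _ ι hn Q hadm
  -- thresholds and ranks
  set B : ℤ := regularityBound (preHilbertPoly ℚ (Nat.card ι) 0) 0 (preHilbertPoly ℚ (Nat.card ι) 0 - Q) with hB
  set e₁ : ℕ := (B - 1).toNat with he₁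
  set R : ℕ → ℕ := fun e => ⌊Q.eval (e : ℚ)⌋₊ with hRdef
  have hBe : ∀ e : ℕ, e₁ ≤ e → B - 1 ≤ (e : ℤ) := fun e he => by
    have := Int.self_le_toNat (B - 1); omega
  have hR : ∀ e, e₁ ≤ e → (R e : ℚ) = Q.eval (e : ℚ) := fun e he => hadm e (hBe e he)
  -- the Hilbert scheme over `ℤ`
  obtain ⟨d, k, e₀, -, he₁, hrep, H, j, hj, hH, ZH₀, iH₀, hiH₀, ⟨hflat₀, hrk₀⟩, huniv₀⟩ :=
    exists_grassmannianImmersion_universal_flat_family hn Q e₁ R hR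
  haveI := hrep; haveI := hj; haveI := hH; haveI := hiH₀; haveI := hflat₀
  -- `HS := H × S` over `S`
  let HS : Scheme.{0} := pullback (terminal.from H) (terminal.from S)
  let πH : HS ⟶ H := pullback.fst _ _
  let h : HS ⟶ S := pullback.snd _ _
  haveI : LocallyOfFiniteType (terminal.from H) := by
    rw [show terminal.from H = j ≫ terminal.from _ from terminal.hom_ext _ _]
    haveI := Grassmannian.locallyOfFiniteType_terminal_from ((Fin d → Fin (Nat.card ι + 1)) →₀ ℤ) k
    infer_instance
  haveI : IsSeparated (terminal.from H) := by
    rw [show terminal.from H = j ≫ terminal.from _ from terminal.hom_ext _ _]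
    haveI := Grassmannian.isSeparated_terminal_from ((Fin d → Fin (Nat.card ι + 1)) →₀ ℤ) k
    infer_instance
  haveI : LocallyOfFiniteType h := MorphismProperty.pullback_snd _ _ inferInstance
  haveI : IsSeparated h := MorphismProperty.pullback_snd _ _ inferInstance
  haveI : IsLocallyNoetherian HS := LocallyOfFiniteType.isLocallyNoetherian h
  -- the universal family pulled back to `HS`
  have Hsq := IsPullback.of_hasPullback iH₀ (Morphisms.projectiveSpaceMap ι πH)
  let ZH : Scheme.{0} := pullback iH₀ (Morphisms.projectiveSpaceMap ι πH)
  let g : ZH ⟶ ZH₀ := pullback.fst _ _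
  let iH : ZH ⟶ Morphisms.projectiveSpace ι HS := pullback.snd _ _
  haveI : IsClosedImmersion iH := MorphismProperty.pullback_snd _ _ inferInstance
  haveI : Flat (iH ≫ Morphisms.projectiveSpaceFst ι HS) :=
    MorphismProperty.of_isPullback (Hsq.paste_vert (Morphisms.isPullback_projectiveSpaceMap ι πH)) inferInstance
  refine ⟨HS, h, inferInstance, inferInstance, inferInstance, ZH, iH, inferInstance, inferInstance, ?_, ?_⟩
  · -- SELF: letters on `H` at `e ≥ B(Q) − 1` (★), transported along `πH`
    intro K _ X₀ k' f₀ x' H' e he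
    have he' : e₁ ≤ e := by
      have := Int.self_le_toNat (B - 1); omega
    obtain ⟨Hx, hψ⟩ := fieldPoint_of_baseChange iH₀ πH g iH Hsq k' f₀ x' H'
    obtain ⟨hvan, hrk, -⟩ := forall_fieldPoint_letters_of_hasRank_twists hn iH₀ Q e₀ R (fun e he => hR e (he₁.trans he)) hrk₀ e
      (R e) (hR e he') he
      (k' ≫ g) f₀ (x' ≫ πH) Hx
    refine ⟨subsingleton_ext_of_iso₅ (unitModule X₀) (hψ e).some.symm 1 hvan, ?_⟩
    obtain ⟨L, -⟩ := Morphisms.exists_secMod_linearEquiv_of_iso f₀.appTop.hom (hψ e).some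
    rw [← L.finrank_eq, hrk]
    exact hR e he'
  · -- UNIV over `S`
    intro T _ v Z i _ _ hlet
    -- letters ⇒ ranks `R e` for `e ≥ e₀`
    have hrk : ∀ e, e₀ ≤ e → HasRank ((Scheme.Modules.pushforward (i ≫ Morphisms.projectiveSpaceFst ι T)).obj
        (twistMod (i ≫ pullback.snd (terminal.from T) (terminal.from (Morphisms.projectiveSpaceInt ι))) (unitModule Z) e))
        (R e) := by
      intro e he
      have heB : B - 1 ≤ (e : ℤ) := hBe e (he₁.trans he)
      refine Modules.hasRank_pushforward_twistMod_of_forall_fieldPoint i e (R e)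
        (fun K _ X₀ k f₀ x H => (hlet k f₀ x H e heB).1) (fun K _ X₀ k f₀ x H => ?_)
      have h2 := (hlet k f₀ x H e heB).2
      have h3 : ((Module.finrank Γ(Spec (CommRingCat.of K), ⊤) (SecMod ((Scheme.Modules.pullback k).obj
          (twistMod (i ≫ pullback.snd (terminal.from T) (terminal.from (Morphisms.projectiveSpaceInt ι))) (unitModule Z) e))
          f₀.appTop.hom ⊤) : ℕ) : ℚ) = (R e : ℚ) := by rw [h2, hR e (he₁.trans he)]
      exact_mod_cast h3
    obtain ⟨v₀, ⟨e', He'⟩, hv₀uniq⟩ := huniv₀ i hrk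
    -- `w := (v₀, v) : T → H × S`
    let w : T ⟶ HS := pullback.lift v₀ v (terminal.hom_ext _ _)
    have hwπ : w ≫ πH = v₀ := pullback.lift_fst _ _ _
    have hwh : w ≫ h = v := pullback.lift_snd _ _ _
    have hPw : Morphisms.projectiveSpaceMap ι v₀ = Morphisms.projectiveSpaceMap ι w ≫ Morphisms.projectiveSpaceMap ι πH := by
      rw [← hwπ, projectiveSpaceMap_comp'']
    refine ⟨w, ⟨hwh, ?_⟩, ?_⟩
    · -- the square over `𝐏(w)`
      refine ⟨pullback.lift e' (i ≫ Morphisms.projectiveSpaceMap ι w) (by rw [Category.assoc, ← hPw]; exact He'.w), ?_⟩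
      exact IsPullback.of_right (by rw [pullback.lift_fst, ← hPw]; exact He') (pullback.lift_snd _ _ _) Hsq
    · -- uniqueness
      rintro w' ⟨hw'h, e'', He''⟩
      have Hbig : IsPullback (e'' ≫ g) i iH₀ (Morphisms.projectiveSpaceMap ι (w' ≫ πH)) := by
        rw [projectiveSpaceMap_comp'']
        exact He''.paste_horiz Hsq
      have hv' : w' ≫ πH = v₀ := hv₀uniq (w' ≫ πH) ⟨e'' ≫ g, Hbig⟩
      apply pullback.hom_ext
      · rw [hv', hwπ]
      · rw [hw'h, hwh]

end Literature.AlgebraicGeometry.Motives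

end
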